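import Summits.CriticalPhenomena.Ising3DConformalLimit.Theorems.HarmonicMomentsIsotropyDilutionTransferNuB2

/-!
# Charging of the scaled subcritical two-point measures from CUBE CHARGING of the critical mass
(route HarmonicMomentsIsotropy, support item stmt-CriticalPhenomena-6036 `TwoPointAsymptoticIsotropy`;
helper of the dilution line `HarmonicDilution → CorrelationLengthWindow → CriticalCubeCharging →
TwoPointAsymptoticIsotropy`, file `…TwoPointAsymptoticIsotropyOfDilution`)

The accepted charging lemma `nu_charge` (`…DilutionTransferNuB2`, item 6037's line) takes a
scale-covariant non-degenerate pointwise scaling limit of the critical correlators (the shared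
existence crux EX, item stmt-CriticalPhenomena-1981) and uses it ONLY through the lattice statement
`LatticeSums.cubeSum_ge_mul_ballSum`: every sup-norm cube `{‖z - w‖_∞ ≤ r}` avoiding the origin
carries, at every small mesh `δ`, a fixed fraction of the critical two-point mass of the ball
`{‖δx‖_∞ ≤ 1}`.  This file records the same lemma with that lattice statement — CUBE CHARGING of
`⟨σ₀σ_x⟩_{β_c}` — as the hypothesis (`nu_charge_of_cubeCharging`; the proof is the proof of
`nu_charge` verbatim after its third line), so that the dilution transfer runs without any scaling
limit.  Cube charging is a doubling / Harnack-type regularity property of the critical two-point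
function on `ℤ³` (true under the conjectured `|x|^{-(1+η)}` law, implied by EX —
`cubeSum_ge_mul_ballSum` — and by item 0634; open unconditionally: Aizenman–Duminil-Copin 2021 only
provide "regular scales", cf. `Literature/Probability/LatticeModels/RegularScales.lean`,
`CriticalAxisRatioRegularity.lean`).

No definitions, no named facts; axioms standard.
-/

noncomputable section

open MeasureTheory Filter Topology Set
open scoped ENNReal NNReal BigOperators
open Literature.Probability.LatticeModels

namespace Summit.CriticalPhenomena.Ising3DConformalLimit.Theorems.HarmonicMomentsIsotropy

open scoped Classical

/-- **The scaled two-point measures charge cubes away from the origin, from cube charging.**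
Assume CUBE CHARGING of the critical two-point mass: for every sup-norm cube `{‖z - w‖_∞ ≤ r}`,
`0 < r < ‖w‖_∞`, there are `q > 0` and `δ₀ > 0` with
`q ∑_{‖δx‖_∞ ≤ 1} ⟨σ₀σₓ⟩_{β_c} ≤ ∑_{δx ∈ cube} ⟨σ₀σₓ⟩_{β_c}` for `0 < δ < δ₀`.  Then, given the
critical window CLW (i) at `ε = 1/2` (scale `s₁`, from `β₁`) and the one-length window CLW (ii)
(from `β₀`), every cube `{‖z - w‖_∞ ≤ r}` with `0 < r < ‖w‖_∞` and `9(‖w‖_∞ + r)² ≤ s₁` receives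
`ν_β`-mass at least a fixed `ι > 0` for all `β` close to `β_c`.  (Proof of `nu_charge` verbatim, the
doubling constant now coming from the hypothesis.) -/
theorem nu_charge_of_cubeCharging
    (hD : ∀ (w : Fin 3 → ℝ) (r : ℝ), 0 < r → r < ‖w‖ → ∃ q : ℝ, 0 < q ∧ ∃ δ₀ : ℝ, 0 < δ₀ ∧
      ∀ δ : ℝ, 0 < δ → δ < δ₀ →
        q * (∑' x : Site 3, if (δ • fun i => ((x i : ℤ) : ℝ)) ∈
            Metric.closedBall (0 : Fin 3 → ℝ) 1 then criticalTwoPoint 3 x else 0) ≤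
          ∑' x : Site 3, (if (δ • fun i => ((x i : ℤ) : ℝ)) ∈ Metric.closedBall w r
            then criticalTwoPoint 3 x else 0))
    {s₁ β₁ : ℝ} (hβ₁ : β₁ < criticalBeta 3)
    (hi : ∀ β : ℝ, β₁ ≤ β → β < criticalBeta 3 → ∀ x : Site 3,
      (∑ i, ((x i : ℤ) : ℝ) ^ 2) * chi β ≤ s₁ * msq β →
        (1 / 2 : ℝ) * criticalTwoPoint 3 x ≤ twoPointFree 3 β x)
    {c₀ C β₀ : ℝ} (hc₀ : 0 < c₀) (hβ₀ : β₀ < criticalBeta 3)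
    (hii : ∀ β : ℝ, β₀ ≤ β → β < criticalBeta 3 → ∀ A : ℝ, 1 ≤ A →
      (∑' x : Site 3, if A ^ 2 * msq β < (∑ i, ((x i : ℤ) : ℝ) ^ 2) * chi β
        then twoPointFree 3 β x else 0) ≤ C * Real.exp (-(c₀ * A)) * chi β)
    (w : Fin 3 → ℝ) {r : ℝ} (hr : 0 < r) (hw : r < ‖w‖)
    (hws : 9 * (‖w‖ + r) ^ 2 ≤ s₁) :
    ∃ ι > 0, ∀ᶠ β in 𝓝[<] (criticalBeta 3),
      ι ≤ ((nu β) {y | WithLp.ofLp y ∈ Metric.closedBall w r}).toReal := by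
  obtain ⟨A₀, hA₀1, hA₀⟩ := exists_tail_scale hc₀ C
  have hA₀pos : 0 < A₀ := lt_of_lt_of_le one_pos hA₀1
  -- the doubling constant for the rescaled cube
  set w' : Fin 3 → ℝ := A₀⁻¹ • w with hw'
  have hnw' : ‖w'‖ = A₀⁻¹ * ‖w‖ := by
    rw [hw', norm_smul, Real.norm_eq_abs, abs_of_pos (inv_pos.2 hA₀pos)]
  obtain ⟨q, hq, δq, hδq, hdoub⟩ := hD w' (r / A₀) (by positivity) (by
      rw [hnw', div_lt_iff₀ hA₀pos]
      calc r < ‖w‖ := hw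
        _ = A₀⁻¹ * ‖w‖ * A₀ := by field_simp)
  refine ⟨q / 4, by positivity, ?_⟩
  -- good `β`: close to `β_c` and `ξ₂` large
  have hξ := tendsto_xi_atTop hc₀ hβ₀ hii
  have hgood : ∀ᶠ β in 𝓝[<] (criticalBeta 3), max (max β₀ β₁) 0 < β ∧ β < criticalBeta 3 := by
    have : Ioo (max (max β₀ β₁) 0) (criticalBeta 3) ∈ 𝓝[<] (criticalBeta 3) :=
      Ioo_mem_nhdsLT (max_lt (max_lt hβ₀ hβ₁) (criticalBeta_pos_holds (d := 3) (by norm_num)))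
    filter_upwards [this] with β hβ using hβ
  filter_upwards [hgood, hξ.eventually_gt_atTop ((A₀ * δq)⁻¹)] with β hβ hξβ
  have hβ0 : 0 < β := lt_of_le_of_lt (le_max_right _ _) hβ.1
  have hβc : β < criticalBeta 3 := hβ.2
  have hββ₀ : β₀ ≤ β := ((le_max_left _ _).trans (le_max_left _ _)).trans hβ.1.le
  have hββ₁ : β₁ ≤ β := ((le_max_right _ _).trans (le_max_left _ _)).trans hβ.1.le
  have hχ := chi_pos hβ0.le hβc
  have hξpos := xi_pos hβ0 hβc
  set ξ : ℝ := xi β with hξdef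
  set δ : ℝ := (A₀ * ξ)⁻¹ with hδ
  have hδpos : 0 < δ := by positivity
  have hδq' : δ < δq := by
    rw [hδ, inv_lt_comm₀ (by positivity) hδq]
    calc δq⁻¹ = (A₀ * δq)⁻¹ * A₀ := by field_simp
      _ < ξ * A₀ := mul_lt_mul_of_pos_right hξβ hA₀pos
      _ = A₀ * ξ := mul_comm _ _
  -- (1) the measure of the cube as a lattice sum
  have hmeas : ((nu β) {y | WithLp.ofLp y ∈ Metric.closedBall w r}).toReal = (chi β)⁻¹ *
      ∑' x : Site 3, (if ξ⁻¹ • siteW x ∈ Metric.closedBall w r then twoPointFree 3 β x else 0) := by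
    rw [nu_apply_toReal hβ0.le hβc, ENNReal.toReal_ofReal]
    · congr 1
    · exact mul_nonneg (inv_nonneg.2 hχ.le) (tsum_nonneg fun x => by
        split_ifs; exacts [IsingInputs.G_nonneg hβ0.le x, le_refl _])
  -- (2) CLW (i): on the cube, `G_β ≥ G_c/2`; and the cube condition at mesh `δ`
  have hcube_iff : ∀ x : Site 3, ξ⁻¹ • siteW x ∈ Metric.closedBall w r ↔
      (δ • fun i => ((x i : ℤ) : ℝ)) ∈ Metric.closedBall w' (r / A₀) := by
    intro x
    have hsw : siteW x = fun i => ((x i : ℤ) : ℝ) := rfl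
    rw [Metric.mem_closedBall, Metric.mem_closedBall, dist_eq_norm, dist_eq_norm, hw', hδ, ← hsw,
      show (A₀ * ξ)⁻¹ • siteW x - A₀⁻¹ • w = A₀⁻¹ • (ξ⁻¹ • siteW x - w) by
        rw [smul_sub, smul_smul, mul_inv], norm_smul, Real.norm_eq_abs,
      abs_of_pos (inv_pos.2 hA₀pos), ← div_eq_inv_mul, div_le_div_iff_of_pos_right hA₀pos]
  have hlow : (∑' x : Site 3, if (δ • fun i => ((x i : ℤ) : ℝ)) ∈ Metric.closedBall w' (r / A₀)
      then (1 / 2 : ℝ) * criticalTwoPoint 3 x else 0) ≤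
      ∑' x : Site 3, (if ξ⁻¹ • siteW x ∈ Metric.closedBall w r then twoPointFree 3 β x else 0) := by
    refine tsum_ite_le_tsum_ite (fun x hx => (hcube_iff x).2 hx)
      (fun x => by positivity [criticalTwoPoint_nonneg' x]) (fun x hx => ?_)
      (fun x => IsingInputs.G_nonneg hβ0.le x) (summable_ite_G hβ0.le hβc _)
    refine hi β hββ₁ hβc x ?_
    -- `|x|² χ ≤ 9(‖w‖+r)² M₂ ≤ s₁ M₂`
    have hx' := (hcube_iff x).2 hx
    rw [Metric.mem_closedBall, dist_eq_norm] at hx'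
    have hn1 : ‖ξ⁻¹ • siteW x‖ ≤ ‖w‖ + r := by
      have := norm_le_norm_sub_add (ξ⁻¹ • siteW x) w
      linarith [norm_sub_rev (ξ⁻¹ • siteW x) w]
    have hn2 : ‖x‖ ≤ (‖w‖ + r) * ξ := by
      rw [norm_smul, Real.norm_eq_abs, abs_of_pos (inv_pos.2 hξpos), ← div_eq_inv_mul,
        div_le_iff₀ hξpos] at hn1
      have : ‖siteW x‖ = ‖x‖ := LatticeSums.norm_intCast_eq x
      linarith [this ▸ hn1]
    have hr2 : (∑ i, ((x i : ℤ) : ℝ) ^ 2) ≤ 9 * ((‖w‖ + r) * ξ) ^ 2 := by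
      rw [← norm_siteV_sq]
      have h9 : ‖siteV x‖ ≤ 3 * ((‖w‖ + r) * ξ) := (norm_siteV_le x).trans (by linarith)
      nlinarith [norm_nonneg (siteV x)]
    have hξ2 : ξ ^ 2 * chi β = msq β := by
      rw [hξdef, xi_sq hβ0.le hβc]; field_simp
    calc (∑ i, ((x i : ℤ) : ℝ) ^ 2) * chi β ≤ 9 * ((‖w‖ + r) * ξ) ^ 2 * chi β :=
          mul_le_mul_of_nonneg_right hr2 hχ.le
      _ = 9 * (‖w‖ + r) ^ 2 * (ξ ^ 2 * chi β) := by ring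
      _ ≤ s₁ * msq β := by rw [hξ2]; exact mul_le_mul_of_nonneg_right hws (msq_nonneg hβ0.le)
  have hlow' : (∑' x : Site 3, if (δ • fun i => ((x i : ℤ) : ℝ)) ∈ Metric.closedBall w' (r / A₀)
      then (1 / 2 : ℝ) * criticalTwoPoint 3 x else 0) = 1 / 2 * ∑' x : Site 3,
        (if (δ • fun i => ((x i : ℤ) : ℝ)) ∈ Metric.closedBall w' (r / A₀)
          then criticalTwoPoint 3 x else 0) := by
    rw [← tsum_mul_left]; refine tsum_congr fun x => ?_; split_ifs <;> ring
  -- (3) doubling at mesh `δ`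
  have hd := hdoub δ hδpos hδq'
  -- (4) the ball sum dominates the head sum, which is `≥ χ/2`
  have hhead : (∑' x : Site 3, if ¬(A₀ ^ 2 * msq β < (∑ i, ((x i : ℤ) : ℝ) ^ 2) * chi β)
      then twoPointFree 3 β x else 0) ≤
      ∑' x : Site 3, (if (δ • fun i => ((x i : ℤ) : ℝ)) ∈ Metric.closedBall (0 : Fin 3 → ℝ) 1
        then criticalTwoPoint 3 x else 0) := by
    refine tsum_ite_le_tsum_ite (fun x hx => ?_) (fun x => IsingInputs.G_nonneg hβ0.le x)
      (fun x _ => IsingInputs.G_le_critical hβ0.le hβc.le x) (fun x => criticalTwoPoint_nonneg' x)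
      (LatticeSums.summable_norm_ite_mem hδpos subset_rfl _).of_norm
    have hn := norm_le_of_not_tail hβ0 hβc (zero_le_one.trans hA₀1) hx
    rw [Metric.mem_closedBall, dist_zero_right, norm_smul, Real.norm_eq_abs, abs_of_pos hδpos,
      LatticeSums.norm_intCast_eq, hδ, ← div_eq_inv_mul, div_le_one (by positivity)]
    exact hn
  have hchi2 := chi_le_two_mul_head hβ0 hβc (hii β hββ₀ hβc A₀ hA₀1) hA₀
  -- (5) assemble: `ν(cube) ≥ χ⁻¹ · (1/2) · q · ballSum ≥ q/4`
  rw [hmeas]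
  have hball_ge : chi β / 2 ≤ ∑' x : Site 3, (if (δ • fun i => ((x i : ℤ) : ℝ)) ∈
      Metric.closedBall (0 : Fin 3 → ℝ) 1 then criticalTwoPoint 3 x else 0) := by linarith
  have key : q / 4 * chi β ≤ ∑' x : Site 3,
      (if ξ⁻¹ • siteW x ∈ Metric.closedBall w r then twoPointFree 3 β x else 0) := by
    calc q / 4 * chi β = 1 / 2 * (q * (chi β / 2)) := by ring
      _ ≤ 1 / 2 * (q * ∑' x : Site 3, (if (δ • fun i => ((x i : ℤ) : ℝ)) ∈
          Metric.closedBall (0 : Fin 3 → ℝ) 1 then criticalTwoPoint 3 x else 0)) := by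
          gcongr
      _ ≤ 1 / 2 * ∑' x : Site 3, (if (δ • fun i => ((x i : ℤ) : ℝ)) ∈
          Metric.closedBall w' (r / A₀) then criticalTwoPoint 3 x else 0) := by
          gcongr
      _ ≤ _ := by rw [← hlow']; exact hlow
  rw [le_inv_mul_iff₀ hχ]
  linarith

end Summit.CriticalPhenomena.Ising3DConformalLimit.Theorems.HarmonicMomentsIsotropy

end
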